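import Summits.ResolutionOfSingularities.ResolutionOfSingularities.Theorems.FrobeniusLadderFInjectiveMacaulayficationT11OriginPointFixableOfCellsMod
import Summits.ResolutionOfSingularities.ResolutionOfSingularities.Theorems.FrobeniusLadderFInjectiveMacaulayficationT11Char11Cells00
import Summits.ResolutionOfSingularities.ResolutionOfSingularities.Theorems.FrobeniusLadderFInjectiveMacaulayficationT11Char11Cells01
import Summits.ResolutionOfSingularities.ResolutionOfSingularities.Theorems.FrobeniusLadderFInjectiveMacaulayficationT11Char11Cells02
import Summits.ResolutionOfSingularities.ResolutionOfSingularities.Theorems.FrobeniusLadderFInjectiveMacaulayficationT11Char11Cells03a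
import Summits.ResolutionOfSingularities.ResolutionOfSingularities.Theorems.FrobeniusLadderFInjectiveMacaulayficationT11Char11Cells03b
import Summits.ResolutionOfSingularities.ResolutionOfSingularities.Theorems.FrobeniusLadderFInjectiveMacaulayficationT11Char11Cells03c
import Summits.ResolutionOfSingularities.ResolutionOfSingularities.Theorems.FrobeniusLadderFInjectiveMacaulayficationT11Char11Cells04
import Summits.ResolutionOfSingularities.ResolutionOfSingularities.Theorems.FrobeniusLadderFInjectiveMacaulayficationT11Char11Cells05
import Summits.ResolutionOfSingularities.ResolutionOfSingularities.Theorems.FrobeniusLadderFInjectiveMacaulayficationT11Char11Cells06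
import Summits.ResolutionOfSingularities.ResolutionOfSingularities.Theorems.FrobeniusLadderFInjectiveMacaulayficationT11Char11Cells07
import Summits.ResolutionOfSingularities.ResolutionOfSingularities.Theorems.FrobeniusLadderFInjectiveMacaulayficationT11Char11Cells08
import Summits.ResolutionOfSingularities.ResolutionOfSingularities.Theorems.FrobeniusLadderFInjectiveMacaulayficationT11Char11Cells09
import Summits.ResolutionOfSingularities.ResolutionOfSingularities.Theorems.FrobeniusLadderFInjectiveMacaulayficationT11Char11Cells10
import Summits.ResolutionOfSingularities.ResolutionOfSingularities.Theorems.FrobeniusLadderFInjectiveMacaulayficationT11Char11Cells11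
import Summits.ResolutionOfSingularities.ResolutionOfSingularities.Theorems.FrobeniusLadderFInjectiveMacaulayficationT11Char11Cells12
import Summits.ResolutionOfSingularities.ResolutionOfSingularities.Theorems.FrobeniusLadderFInjectiveMacaulayficationT11Char11Cells13
import Summits.ResolutionOfSingularities.ResolutionOfSingularities.Theorems.FrobeniusLadderFInjectiveMacaulayficationT11Char11Cells14
import Summits.ResolutionOfSingularities.ResolutionOfSingularities.Theorems.FrobeniusLadderFInjectiveMacaulayficationT11Char11Cells15a
import Summits.ResolutionOfSingularities.ResolutionOfSingularities.Theorems.FrobeniusLadderFInjectiveMacaulayficationT11Char11Cells15b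
import Summits.ResolutionOfSingularities.ResolutionOfSingularities.Theorems.FrobeniusLadderFInjectiveMacaulayficationT11Char11Cells15c
import Summits.ResolutionOfSingularities.ResolutionOfSingularities.Theorems.FrobeniusLadderFInjectiveMacaulayficationT11Char11Cells16
import Summits.ResolutionOfSingularities.ResolutionOfSingularities.Theorems.FrobeniusLadderFInjectiveMacaulayficationT11Char11Cells17a
import Summits.ResolutionOfSingularities.ResolutionOfSingularities.Theorems.FrobeniusLadderFInjectiveMacaulayficationT11Char11Cells17b
import Summits.ResolutionOfSingularities.ResolutionOfSingularities.Theorems.FrobeniusLadderFInjectiveMacaulayficationT11Char11Cells17c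
import Summits.ResolutionOfSingularities.ResolutionOfSingularities.Theorems.FrobeniusLadderFInjectiveMacaulayficationT11Char11Cells18
import Summits.ResolutionOfSingularities.ResolutionOfSingularities.Theorems.FrobeniusLadderFInjectiveMacaulayficationT11Char11Cells19
import Summits.ResolutionOfSingularities.ResolutionOfSingularities.Theorems.FrobeniusLadderFInjectiveMacaulayficationT11Char11Cells20
import Summits.ResolutionOfSingularities.ResolutionOfSingularities.Theorems.FrobeniusLadderFInjectiveMacaulayficationT11Char11Cells21
import Summits.ResolutionOfSingularities.ResolutionOfSingularities.Theorems.FrobeniusLadderFInjectiveMacaulayficationT11Char11Cells22a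
import Summits.ResolutionOfSingularities.ResolutionOfSingularities.Theorems.FrobeniusLadderFInjectiveMacaulayficationT11Char11Cells22b
import Summits.ResolutionOfSingularities.ResolutionOfSingularities.Theorems.FrobeniusLadderFInjectiveMacaulayficationT11Char11Cells22c
import Summits.ResolutionOfSingularities.ResolutionOfSingularities.Theorems.FrobeniusLadderFInjectiveMacaulayficationT11Char11Cells23
import Summits.ResolutionOfSingularities.ResolutionOfSingularities.Theorems.FrobeniusLadderFInjectiveMacaulayficationT11Char11Cells24
import Summits.ResolutionOfSingularities.ResolutionOfSingularities.Theorems.FrobeniusLadderFInjectiveMacaulayficationT11Char11Cells25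
import Summits.ResolutionOfSingularities.ResolutionOfSingularities.Theorems.FrobeniusLadderFInjectiveMacaulayficationT11Char11Cells26a
import Summits.ResolutionOfSingularities.ResolutionOfSingularities.Theorems.FrobeniusLadderFInjectiveMacaulayficationT11Char11Cells26b
import Summits.ResolutionOfSingularities.ResolutionOfSingularities.Theorems.FrobeniusLadderFInjectiveMacaulayficationT11Char11Cells26c
import Summits.ResolutionOfSingularities.ResolutionOfSingularities.Theorems.FrobeniusLadderFInjectiveMacaulayficationT11Char11Cells27a
import Summits.ResolutionOfSingularities.ResolutionOfSingularities.Theorems.FrobeniusLadderFInjectiveMacaulayficationT11Char11Cells27b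
import Summits.ResolutionOfSingularities.ResolutionOfSingularities.Theorems.FrobeniusLadderFInjectiveMacaulayficationT11Char11Cells27c
import Summits.ResolutionOfSingularities.ResolutionOfSingularities.Theorems.FrobeniusLadderFInjectiveMacaulayficationT11Char11Cells28
import HarnessLib

/-!
# THE ROAD-B INSTANCE `T₁₁ / 11`: the crux statement for `X = T₁₁⁺` over every field of characteristic `11`
# (crux `FInjectiveMacaulayfication`, road B / U11 truncated cells; res-L1-w45a-plan-1 R13.43 (3); seat res-D-pv-018 AS res-L1-w45a-stub-6)

[OURS · L1 W4.5a] Support file for crux stmt-ResolutionOfSingularities-15315.  Assembly only: the 87 per-chart TRUNCATED cell packages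
(`T11Char11Cells<NN>.chart<c>_cells` from the 3-chart modules `T11Char11Cells00…28` and — where a 3-chart text exceeded the gate's 600 s elaboration cap — from the
one-chart RE-CUT modules `T11Char11Cells<NN>x`, <NN>x ∈ {03abc, 15abc, 17abc, 22abc, 26abc, 27abc}; `KLocCellMod`'s `hcellsMod` binder, one `decide +kernel` each through `KLocCellKit.klocCellsMod_of_check'`
on res-L1-w45a-stub-2's toric certificate cert-T11-own-p11.v1.1.json 23cd16d2e90266c7 made with res-L1-w45a-tri-1's tools) are collected
over `c : Fin 87` against the tables `T11Char7Poly.G` / `T11Char7Poly.SS` (identical chart data at every `p`) by `RoadBFrameMod.cellsMod_transport`,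
and fed to `T11OriginPointFixableOfCellsMod.fInjectiveMacaulayfication_T11plus_of_cellsMod 11` (frame `RoadBFrameMod` over
`KLocCellMod.honQuot_of_kLocCells_mod_range`, doors `T11SpecimenDoorWide` / stalk transport by res-L1-w45a-stub-2 and -stub-3).  AI-built and AI-reviewed
only (weaker than expert review); an instance of OUR crux statement on OUR specimen; it uses no statement of [claim: Hironaka2017] and says
nothing about the manuscript or about resolution of singularities in general. [folklore glue]
-/

-- single-problem summit: the doubled namespace component is forced
set_option linter.dupNamespace false

noncomputable section

namespace Summit.ResolutionOfSingularities.ResolutionOfSingularities.Theorems.FInjectiveMacaulayfication.T11OriginPointFixableChar11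

open MvPolynomial AlgebraicGeometry
open Summit.ResolutionOfSingularities.ResolutionOfSingularities.Theorems.FInjectiveMacaulayfication

/-- The 87 TRUNCATED cell packages at `p = 11`, collected over `c : Fin 87` against the tables `T11Char7Poly.G` / `T11Char7Poly.SS`
(each entry is the generated theorem `T11Char11Cells<NN>.chart<c>_cells`, transported by `RoadBFrameMod.cellsMod_transport`; the strata-list
equality and the term-list permutation side goals close by `decide +kernel`). [folklore] -/
theorem cells_all (k : Type) [Field k] [CharP k 11] : ∀ (c : Fin 87), ∀ S ∈ T11Char7Poly.SS c,
    ∃ (L : List ((Fin 4 →₀ ℕ) × MvPolynomial (Fin 4) k)) (rr : List (MvPolynomial (Fin 4) k))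
      (tt : Fin 4 → MvPolynomial (Fin 4) k) (t₀ : MvPolynomial (Fin 4) k),
      (L.map Prod.fst).Nodup ∧ (∀ e ∈ L, ∀ i : Fin 4, e.1 i < 11) ∧
      KLocCellKit.evalL k (T11Char7Poly.G c) ^ (11 - 1) - (L.map fun e => MvPolynomial.monomial e.1 (1 : k) * MvPolynomial.expand 11 e.2).sum ∈
        Ideal.span ((fun i : Fin 4 => (MvPolynomial.X i : MvPolynomial (Fin 4) k) ^ 11) '' (S : Set (Fin 4))) ∧
      (1 : MvPolynomial (Fin 4) k) = (List.zipWith (fun r e => r * MvPolynomial.expand 11 e.2) rr L).sum +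
        ∑ i ∈ S, tt i * MvPolynomial.X i + t₀ * KLocCellKit.evalL k (T11Char7Poly.G c) := by
  intro c
  fin_cases c
  · exact RoadBFrameMod.cellsMod_transport 11 k (by decide +kernel) (by decide +kernel) (T11Char11Cells00.chart0_cells k)
  · exact RoadBFrameMod.cellsMod_transport 11 k (by decide +kernel) (by decide +kernel) (T11Char11Cells00.chart1_cells k)
  · exact RoadBFrameMod.cellsMod_transport 11 k (by decide +kernel) (by decide +kernel) (T11Char11Cells00.chart2_cells k)
  · exact RoadBFrameMod.cellsMod_transport 11 k (by decide +kernel) (by decide +kernel) (T11Char11Cells01.chart3_cells k)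
  · exact RoadBFrameMod.cellsMod_transport 11 k (by decide +kernel) (by decide +kernel) (T11Char11Cells01.chart4_cells k)
  · exact RoadBFrameMod.cellsMod_transport 11 k (by decide +kernel) (by decide +kernel) (T11Char11Cells01.chart5_cells k)
  · exact RoadBFrameMod.cellsMod_transport 11 k (by decide +kernel) (by decide +kernel) (T11Char11Cells02.chart6_cells k)
  · exact RoadBFrameMod.cellsMod_transport 11 k (by decide +kernel) (by decide +kernel) (T11Char11Cells02.chart7_cells k)
  · exact RoadBFrameMod.cellsMod_transport 11 k (by decide +kernel) (by decide +kernel) (T11Char11Cells02.chart8_cells k)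
  · exact RoadBFrameMod.cellsMod_transport 11 k (by decide +kernel) (by decide +kernel) (T11Char11Cells03a.chart9_cells k)
  · exact RoadBFrameMod.cellsMod_transport 11 k (by decide +kernel) (by decide +kernel) (T11Char11Cells03b.chart10_cells k)
  · exact RoadBFrameMod.cellsMod_transport 11 k (by decide +kernel) (by decide +kernel) (T11Char11Cells03c.chart11_cells k)
  · exact RoadBFrameMod.cellsMod_transport 11 k (by decide +kernel) (by decide +kernel) (T11Char11Cells04.chart12_cells k)
  · exact RoadBFrameMod.cellsMod_transport 11 k (by decide +kernel) (by decide +kernel) (T11Char11Cells04.chart13_cells k)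
  · exact RoadBFrameMod.cellsMod_transport 11 k (by decide +kernel) (by decide +kernel) (T11Char11Cells04.chart14_cells k)
  · exact RoadBFrameMod.cellsMod_transport 11 k (by decide +kernel) (by decide +kernel) (T11Char11Cells05.chart15_cells k)
  · exact RoadBFrameMod.cellsMod_transport 11 k (by decide +kernel) (by decide +kernel) (T11Char11Cells05.chart16_cells k)
  · exact RoadBFrameMod.cellsMod_transport 11 k (by decide +kernel) (by decide +kernel) (T11Char11Cells05.chart17_cells k)
  · exact RoadBFrameMod.cellsMod_transport 11 k (by decide +kernel) (by decide +kernel) (T11Char11Cells06.chart18_cells k)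
  · exact RoadBFrameMod.cellsMod_transport 11 k (by decide +kernel) (by decide +kernel) (T11Char11Cells06.chart19_cells k)
  · exact RoadBFrameMod.cellsMod_transport 11 k (by decide +kernel) (by decide +kernel) (T11Char11Cells06.chart20_cells k)
  · exact RoadBFrameMod.cellsMod_transport 11 k (by decide +kernel) (by decide +kernel) (T11Char11Cells07.chart21_cells k)
  · exact RoadBFrameMod.cellsMod_transport 11 k (by decide +kernel) (by decide +kernel) (T11Char11Cells07.chart22_cells k)
  · exact RoadBFrameMod.cellsMod_transport 11 k (by decide +kernel) (by decide +kernel) (T11Char11Cells07.chart23_cells k)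
  · exact RoadBFrameMod.cellsMod_transport 11 k (by decide +kernel) (by decide +kernel) (T11Char11Cells08.chart24_cells k)
  · exact RoadBFrameMod.cellsMod_transport 11 k (by decide +kernel) (by decide +kernel) (T11Char11Cells08.chart25_cells k)
  · exact RoadBFrameMod.cellsMod_transport 11 k (by decide +kernel) (by decide +kernel) (T11Char11Cells08.chart26_cells k)
  · exact RoadBFrameMod.cellsMod_transport 11 k (by decide +kernel) (by decide +kernel) (T11Char11Cells09.chart27_cells k)
  · exact RoadBFrameMod.cellsMod_transport 11 k (by decide +kernel) (by decide +kernel) (T11Char11Cells09.chart28_cells k)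
  · exact RoadBFrameMod.cellsMod_transport 11 k (by decide +kernel) (by decide +kernel) (T11Char11Cells09.chart29_cells k)
  · exact RoadBFrameMod.cellsMod_transport 11 k (by decide +kernel) (by decide +kernel) (T11Char11Cells10.chart30_cells k)
  · exact RoadBFrameMod.cellsMod_transport 11 k (by decide +kernel) (by decide +kernel) (T11Char11Cells10.chart31_cells k)
  · exact RoadBFrameMod.cellsMod_transport 11 k (by decide +kernel) (by decide +kernel) (T11Char11Cells10.chart32_cells k)
  · exact RoadBFrameMod.cellsMod_transport 11 k (by decide +kernel) (by decide +kernel) (T11Char11Cells11.chart33_cells k)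
  · exact RoadBFrameMod.cellsMod_transport 11 k (by decide +kernel) (by decide +kernel) (T11Char11Cells11.chart34_cells k)
  · exact RoadBFrameMod.cellsMod_transport 11 k (by decide +kernel) (by decide +kernel) (T11Char11Cells11.chart35_cells k)
  · exact RoadBFrameMod.cellsMod_transport 11 k (by decide +kernel) (by decide +kernel) (T11Char11Cells12.chart36_cells k)
  · exact RoadBFrameMod.cellsMod_transport 11 k (by decide +kernel) (by decide +kernel) (T11Char11Cells12.chart37_cells k)
  · exact RoadBFrameMod.cellsMod_transport 11 k (by decide +kernel) (by decide +kernel) (T11Char11Cells12.chart38_cells k)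
  · exact RoadBFrameMod.cellsMod_transport 11 k (by decide +kernel) (by decide +kernel) (T11Char11Cells13.chart39_cells k)
  · exact RoadBFrameMod.cellsMod_transport 11 k (by decide +kernel) (by decide +kernel) (T11Char11Cells13.chart40_cells k)
  · exact RoadBFrameMod.cellsMod_transport 11 k (by decide +kernel) (by decide +kernel) (T11Char11Cells13.chart41_cells k)
  · exact RoadBFrameMod.cellsMod_transport 11 k (by decide +kernel) (by decide +kernel) (T11Char11Cells14.chart42_cells k)
  · exact RoadBFrameMod.cellsMod_transport 11 k (by decide +kernel) (by decide +kernel) (T11Char11Cells14.chart43_cells k)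
  · exact RoadBFrameMod.cellsMod_transport 11 k (by decide +kernel) (by decide +kernel) (T11Char11Cells14.chart44_cells k)
  · exact RoadBFrameMod.cellsMod_transport 11 k (by decide +kernel) (by decide +kernel) (T11Char11Cells15a.chart45_cells k)
  · exact RoadBFrameMod.cellsMod_transport 11 k (by decide +kernel) (by decide +kernel) (T11Char11Cells15b.chart46_cells k)
  · exact RoadBFrameMod.cellsMod_transport 11 k (by decide +kernel) (by decide +kernel) (T11Char11Cells15c.chart47_cells k)
  · exact RoadBFrameMod.cellsMod_transport 11 k (by decide +kernel) (by decide +kernel) (T11Char11Cells16.chart48_cells k)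
  · exact RoadBFrameMod.cellsMod_transport 11 k (by decide +kernel) (by decide +kernel) (T11Char11Cells16.chart49_cells k)
  · exact RoadBFrameMod.cellsMod_transport 11 k (by decide +kernel) (by decide +kernel) (T11Char11Cells16.chart50_cells k)
  · exact RoadBFrameMod.cellsMod_transport 11 k (by decide +kernel) (by decide +kernel) (T11Char11Cells17a.chart51_cells k)
  · exact RoadBFrameMod.cellsMod_transport 11 k (by decide +kernel) (by decide +kernel) (T11Char11Cells17b.chart52_cells k)
  · exact RoadBFrameMod.cellsMod_transport 11 k (by decide +kernel) (by decide +kernel) (T11Char11Cells17c.chart53_cells k)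
  · exact RoadBFrameMod.cellsMod_transport 11 k (by decide +kernel) (by decide +kernel) (T11Char11Cells18.chart54_cells k)
  · exact RoadBFrameMod.cellsMod_transport 11 k (by decide +kernel) (by decide +kernel) (T11Char11Cells18.chart55_cells k)
  · exact RoadBFrameMod.cellsMod_transport 11 k (by decide +kernel) (by decide +kernel) (T11Char11Cells18.chart56_cells k)
  · exact RoadBFrameMod.cellsMod_transport 11 k (by decide +kernel) (by decide +kernel) (T11Char11Cells19.chart57_cells k)
  · exact RoadBFrameMod.cellsMod_transport 11 k (by decide +kernel) (by decide +kernel) (T11Char11Cells19.chart58_cells k)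
  · exact RoadBFrameMod.cellsMod_transport 11 k (by decide +kernel) (by decide +kernel) (T11Char11Cells19.chart59_cells k)
  · exact RoadBFrameMod.cellsMod_transport 11 k (by decide +kernel) (by decide +kernel) (T11Char11Cells20.chart60_cells k)
  · exact RoadBFrameMod.cellsMod_transport 11 k (by decide +kernel) (by decide +kernel) (T11Char11Cells20.chart61_cells k)
  · exact RoadBFrameMod.cellsMod_transport 11 k (by decide +kernel) (by decide +kernel) (T11Char11Cells20.chart62_cells k)
  · exact RoadBFrameMod.cellsMod_transport 11 k (by decide +kernel) (by decide +kernel) (T11Char11Cells21.chart63_cells k)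
  · exact RoadBFrameMod.cellsMod_transport 11 k (by decide +kernel) (by decide +kernel) (T11Char11Cells21.chart64_cells k)
  · exact RoadBFrameMod.cellsMod_transport 11 k (by decide +kernel) (by decide +kernel) (T11Char11Cells21.chart65_cells k)
  · exact RoadBFrameMod.cellsMod_transport 11 k (by decide +kernel) (by decide +kernel) (T11Char11Cells22a.chart66_cells k)
  · exact RoadBFrameMod.cellsMod_transport 11 k (by decide +kernel) (by decide +kernel) (T11Char11Cells22b.chart67_cells k)
  · exact RoadBFrameMod.cellsMod_transport 11 k (by decide +kernel) (by decide +kernel) (T11Char11Cells22c.chart68_cells k)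
  · exact RoadBFrameMod.cellsMod_transport 11 k (by decide +kernel) (by decide +kernel) (T11Char11Cells23.chart69_cells k)
  · exact RoadBFrameMod.cellsMod_transport 11 k (by decide +kernel) (by decide +kernel) (T11Char11Cells23.chart70_cells k)
  · exact RoadBFrameMod.cellsMod_transport 11 k (by decide +kernel) (by decide +kernel) (T11Char11Cells23.chart71_cells k)
  · exact RoadBFrameMod.cellsMod_transport 11 k (by decide +kernel) (by decide +kernel) (T11Char11Cells24.chart72_cells k)
  · exact RoadBFrameMod.cellsMod_transport 11 k (by decide +kernel) (by decide +kernel) (T11Char11Cells24.chart73_cells k)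
  · exact RoadBFrameMod.cellsMod_transport 11 k (by decide +kernel) (by decide +kernel) (T11Char11Cells24.chart74_cells k)
  · exact RoadBFrameMod.cellsMod_transport 11 k (by decide +kernel) (by decide +kernel) (T11Char11Cells25.chart75_cells k)
  · exact RoadBFrameMod.cellsMod_transport 11 k (by decide +kernel) (by decide +kernel) (T11Char11Cells25.chart76_cells k)
  · exact RoadBFrameMod.cellsMod_transport 11 k (by decide +kernel) (by decide +kernel) (T11Char11Cells25.chart77_cells k)
  · exact RoadBFrameMod.cellsMod_transport 11 k (by decide +kernel) (by decide +kernel) (T11Char11Cells26a.chart78_cells k)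
  · exact RoadBFrameMod.cellsMod_transport 11 k (by decide +kernel) (by decide +kernel) (T11Char11Cells26b.chart79_cells k)
  · exact RoadBFrameMod.cellsMod_transport 11 k (by decide +kernel) (by decide +kernel) (T11Char11Cells26c.chart80_cells k)
  · exact RoadBFrameMod.cellsMod_transport 11 k (by decide +kernel) (by decide +kernel) (T11Char11Cells27a.chart81_cells k)
  · exact RoadBFrameMod.cellsMod_transport 11 k (by decide +kernel) (by decide +kernel) (T11Char11Cells27b.chart82_cells k)
  · exact RoadBFrameMod.cellsMod_transport 11 k (by decide +kernel) (by decide +kernel) (T11Char11Cells27c.chart83_cells k)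
  · exact RoadBFrameMod.cellsMod_transport 11 k (by decide +kernel) (by decide +kernel) (T11Char11Cells28.chart84_cells k)
  · exact RoadBFrameMod.cellsMod_transport 11 k (by decide +kernel) (by decide +kernel) (T11Char11Cells28.chart85_cells k)
  · exact RoadBFrameMod.cellsMod_transport 11 k (by decide +kernel) (by decide +kernel) (T11Char11Cells28.chart86_cells k)

/-- **THE ROAD-B INSTANCE `T₁₁ / 11` — THE CRUX STATEMENT FOR `X = T₁₁⁺` OVER EVERY FIELD OF CHARACTERISTIC `11`, UNCONDITIONAL.**
`T₁₁⁺ = V(Φ − y² − x³, z² + Φ³ + x¹¹ + w⁷) ⊂ 𝔸⁵_k`, `char k = 11`, has an F-injective Macaulayfication in the sense of the crux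
`FrobeniusLadder.FInjectiveMacaulayfication` (a proper birational `π : X' → X`, every stalk of `X'` a domain in which every s.o.p. is weakly
regular with Frobenius-closed ideal): `T11OriginPointFixableOfCellsMod.fInjectiveMacaulayfication_T11plus_of_cellsMod 11` applied to `cells_all`.
[OURS · L1 W4.5a; AI-built, weaker than expert review; the certificate mathematics is res-L1-w45a-tri-1's / res-L1-w45a-stub-2's] -/
theorem fInjectiveMacaulayfication_T11plus_char11 (k : Type) [Field k] [CharP k 11] (Fs : Fin 2 → MvPolynomial (Fin 5) k)
    (hF₀ : Fs 0 = X 4 - X 1 ^ 2 - X 0 ^ 3) (hF₁ : Fs 1 = X 2 ^ 2 + X 4 ^ 3 + X 0 ^ 11 + X 3 ^ 7) :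
    ∃ (X' : Scheme.{0}) (π : X' ⟶ (Spec (.of (MvPolynomial (Fin 5) k ⧸ Ideal.span (Set.range Fs))))),
      IsProper π ∧ Literature.AlgebraicGeometry.Resolution.IsBirational π ∧
      ∀ x : X', IsDomain (X'.presheaf.stalk x) ∧ ∀ d : ℕ, ringKrullDim (X'.presheaf.stalk x) = d →
        ∀ s : Fin d → X'.presheaf.stalk x, (Ideal.span (Set.range s)).radical.IsMaximal →
          RingTheory.Sequence.IsWeaklyRegular (X'.presheaf.stalk x) (List.ofFn s) ∧
          ∀ y : X'.presheaf.stalk x, (∃ e : ℕ, y ^ 11 ^ e ∈ Ideal.span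
            ((fun z : X'.presheaf.stalk x => z ^ 11 ^ e) '' (Ideal.span (Set.range s) : Set (X'.presheaf.stalk x)))) →
            y ∈ Ideal.span (Set.range s) :=
  haveI : Fact (Nat.Prime 11) := ⟨by decide⟩
  T11OriginPointFixableOfCellsMod.fInjectiveMacaulayfication_T11plus_of_cellsMod 11 (by decide) (by decide) (by decide) k Fs hF₀ hF₁
    (cells_all k)

end Summit.ResolutionOfSingularities.ResolutionOfSingularities.Theorems.FInjectiveMacaulayfication.T11OriginPointFixableChar11

end
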